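import Literature.IUT.HodgeTheaters.LocalFrobenioidsWitness
import Mathlib.Topology.Algebra.ContinuousMonoidHom
import HarnessLib

/-!
# `(𝒪^▷_ℂ, (0,1])` is TOPOLOGICALLY split: the printed condition of `TM⊢` holds for the intended object

Mochizuki, *Inter-universal Teichmüller Theory I: Construction of Hodge Theaters*, kurims manuscript
(May 2020), Example 3.4, p. 81 [cite: Mochizuki2012, I Ex 3.4 p.81] (D-0012 claim key, status disputed;
nothing of the series is asserted here — this file proves an elementary fact about `ℂ`, the polar
decomposition of the punctured closed unit disc with its continuity, and records it against the typed
interface of abc-iut-L5-t2's `LocalFrobenioidsArch.lean` / `LocalFrobenioidsWitness.lean`).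

Print (p. 81, ll. 2–7, recalling [AbsTopIII] Def. 5.6 (i)): "recall the category `TM⊢` of “split
topological monoids” … objects `(C, C→)` consisting of a topological monoid `C` isomorphic to `𝒪^▷_ℂ` and
a topological submonoid `C→ ⊆ C` [necessarily isomorphic to `ℝ_{≥0}`] such that the natural inclusions
`C^× ↪ C`, `C→ ↪ C` determine an isomorphism `C^× × C→ ⥲ C` of topological monoids"; p. 81 l. 17: "the
CAF's `K_v`, `𝒜_{𝒟_v}` determine, in a natural way, objects of `TM⊢`".

`LocalFrobenioidsArch.lean` types `TM⊢` as `SplitTopMonoid` (field `split` = bijectivity of the product map,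
a declared widening) and, after referee finding G3-F1, the PRINTED topological condition as the predicate
`SplitTopMonoid.IsTopSplit` (the product map `C^× × C→ → C` is a homeomorphism), whose docstring promises
that "the objects of interest (`𝒪^▷` of a CAF with `(0, 1]`) satisfy it". `LocalFrobenioidsWitness.lean`
inhabits `TM⊢` by the intended object `SplitTopMonoid.ofComplex = (𝒪^▷_ℂ, (0,1])` with `split` PROVED
(`Witness.split_bijective`). Referee obs M8-O1 (HOME/ref/REFEREE-PASS-M8.md §M8-2) asks for the missing
non-vacuity witness of the printed condition. THIS FILE (theorems only; no new interface) supplies it: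

* `Witness.exists_continuous_polarDecomposition` — the polar decomposition `z ↦ (z/‖z‖, ‖z‖)` is a
  CONTINUOUS map `𝒪^▷_ℂ → (𝒪^▷_ℂ)^× × (0,1]` (every element of `𝒪^▷_ℂ` is nonzero) and a section of the
  product map;
* `Witness.continuous_splitMap` — the product map `(u, r) ↦ u·r` is continuous;
* `Witness.exists_splitHomeomorph` / `Witness.exists_splitContinuousMulEquiv` — the product map
  `(𝒪^▷_ℂ)^× × (0,1] ⥲ 𝒪^▷_ℂ` is a homeomorphism, indeed an isomorphism of topological monoids (the printed
  phrase verbatim);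
* `SplitTopMonoid.ofComplex_isTopSplit : SplitTopMonoid.ofComplex.IsTopSplit` — the promised witness;
* `SplitTopMonoid.exists_isTopSplit` — statements hypothesising `IsTopSplit` ([AbsTopIII] Prop. 5.8 (vi)
  as consumed in Ex. 3.4 (ii)/(iii)) are therefore not vacuous.

What this does NOT say: nothing about the archimedean Frobenioid `𝒞_v` of Ex. 3.4 or the Kummer /
Aut-holomorphic reconstructions of (ii)/(iii) ([AbsTopIII] Cor. 2.7, Prop. 5.8 — abc-iut-L4-t2/t3); only the
elementary topology of `𝒪^▷_ℂ = {z ∈ ℂ | z ≠ 0, |z| ≤ 1}`.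
-/

namespace Literature.IUT.HodgeTheaters

namespace Witness

/-! ### The polar decomposition on `𝒪^▷_ℂ` is continuous -/

/-- An element of `𝒪^▷_ℂ` has nonzero norm (it is nonzero by definition of `unitDiscMonoid`). [folklore] -/
private theorem norm_coe_ne_zero (z : unitDiscMonoid ℂ) : ‖(z : ℂ)‖ ≠ 0 := norm_ne_zero_iff.mpr z.2.1

/-- … hence, cast into `ℂ`, `(‖z‖ : ℂ) ≠ 0`. [folklore] -/
private theorem ofReal_norm_ne_zero (z : unitDiscMonoid ℂ) : ((‖(z : ℂ)‖ : ℝ) : ℂ) ≠ 0 := by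
  exact_mod_cast norm_coe_ne_zero z

/-- The angular part `z/‖z‖` of `z ∈ 𝒪^▷_ℂ` has norm `1`. [folklore] -/
private theorem norm_angular (z : unitDiscMonoid ℂ) : ‖(z : ℂ) * (((‖(z : ℂ)‖ : ℝ) : ℂ))⁻¹‖ = 1 := by
  rw [norm_mul, norm_inv, Complex.norm_real, Real.norm_of_nonneg (norm_nonneg _),
    mul_inv_cancel₀ (norm_coe_ne_zero z)]

/-- The norm of `z ∈ 𝒪^▷_ℂ`, as a complex number, lies in `𝒪^▷_ℂ`. [folklore] -/
private theorem ofReal_norm_mem (z : unitDiscMonoid ℂ) : ((‖(z : ℂ)‖ : ℝ) : ℂ) ∈ unitDiscMonoid ℂ :=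
  ⟨ofReal_norm_ne_zero z, by rw [Complex.norm_real, Real.norm_of_nonneg (norm_nonneg _)]; exact z.2.2⟩

/-- The map `z ↦ z/‖z‖ : 𝒪^▷_ℂ → ℂ` is continuous (the norm never vanishes on `𝒪^▷_ℂ`). [folklore] -/
private theorem continuous_angular :
    Continuous fun z : unitDiscMonoid ℂ => (z : ℂ) * (((‖(z : ℂ)‖ : ℝ) : ℂ))⁻¹ :=
  continuous_subtype_val.mul
    ((Complex.continuous_ofReal.comp (continuous_norm.comp continuous_subtype_val)).inv₀
      ofReal_norm_ne_zero)

/-- **Polar decomposition of `𝒪^▷_ℂ` with CONTINUOUS components.** There is a continuous map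
`g = (g₁, g₂) : 𝒪^▷_ℂ → (𝒪^▷_ℂ)^× × (0,1]` (for the unit-group topology on the first factor, i.e. both
`g₁ z` and `(g₁ z)⁻¹` vary continuously) with `g₁ z · g₂ z = z`, namely `g₁ z = z/‖z‖ ∈ 𝒪^×_ℂ` (the compact
factor `C^×`, p. 81) and `g₂ z = ‖z‖ ∈ (0,1]` (the splitting `C→`, p. 81). It is a section of the product
map of `Witness.split_bijective`, hence its inverse. [claim: Mochizuki2012, status: disputed] -/
theorem exists_continuous_polarDecomposition :
    ∃ g : unitDiscMonoid ℂ → (unitDiscMonoid ℂ)ˣ × vecC,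
      Continuous g ∧
      (∀ z, (((g z).1 : (unitDiscMonoid ℂ)ˣ) : unitDiscMonoid ℂ) * ((g z).2 : unitDiscMonoid ℂ) = z) ∧
      (∀ z, ((((g z).1 : (unitDiscMonoid ℂ)ˣ) : unitDiscMonoid ℂ) : ℂ) =
        (z : ℂ) * (((‖(z : ℂ)‖ : ℝ) : ℂ))⁻¹) ∧
      (∀ z, ((((g z).2 : vecC) : unitDiscMonoid ℂ) : ℂ) = ((‖(z : ℂ)‖ : ℝ) : ℂ)) := by
  refine ⟨fun z => (unitOfNormOne _ (norm_angular z),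
      ⟨⟨((‖(z : ℂ)‖ : ℝ) : ℂ), ofReal_norm_mem z⟩, ⟨‖(z : ℂ)‖, norm_pos_iff.mpr z.2.1, z.2.2, rfl⟩⟩),
    ?_, ?_, fun _ => rfl, fun _ => rfl⟩
  · refine Continuous.prodMk (Units.continuous_iff.2 ⟨?_, ?_⟩) ?_
    · exact continuous_angular.subtype_mk _
    · exact (continuous_angular.inv₀ fun z =>
        mul_ne_zero z.2.1 (inv_ne_zero (ofReal_norm_ne_zero z))).subtype_mk _
    · exact ((Complex.continuous_ofReal.comp (continuous_norm.comp continuous_subtype_val)).subtype_mk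
        _).subtype_mk _
  · intro z
    apply Subtype.ext
    change (z : ℂ) * (((‖(z : ℂ)‖ : ℝ) : ℂ))⁻¹ * (((‖(z : ℂ)‖ : ℝ) : ℂ)) = (z : ℂ)
    rw [mul_assoc, inv_mul_cancel₀ (ofReal_norm_ne_zero z), mul_one]

/-- The product map `(u, r) ↦ u · r : (𝒪^▷_ℂ)^× × (0,1] → 𝒪^▷_ℂ` ("the natural inclusions `C^× ↪ C`,
`C→ ↪ C` determine …", p. 81) is continuous. [claim: Mochizuki2012, status: disputed] -/
theorem continuous_splitMap :
    Continuous fun p : (unitDiscMonoid ℂ)ˣ × vecC =>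
      ((p.1 : (unitDiscMonoid ℂ)ˣ) : unitDiscMonoid ℂ) * (p.2 : unitDiscMonoid ℂ) :=
  (Units.continuous_val.comp continuous_fst).mul (continuous_subtype_val.comp continuous_snd)

/-- **The product map `(𝒪^▷_ℂ)^× × (0, 1] ⥲ 𝒪^▷_ℂ` is a HOMEOMORPHISM** (bijective by
`Witness.split_bijective`; inverse = the continuous polar decomposition): the topological content of the
printed "isomorphism `C^× × C→ ⥲ C` of topological monoids" (p. 81) for the intended object `(𝒪^▷_ℂ, (0,1])`.
[claim: Mochizuki2012, status: disputed] -/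
theorem exists_splitHomeomorph :
    ∃ h : ((unitDiscMonoid ℂ)ˣ × vecC) ≃ₜ unitDiscMonoid ℂ,
      ∀ p, h p = ((p.1 : (unitDiscMonoid ℂ)ˣ) : unitDiscMonoid ℂ) * (p.2 : unitDiscMonoid ℂ) := by
  obtain ⟨g, hg, hsec, -, -⟩ := exists_continuous_polarDecomposition
  exact ⟨{ toFun := fun p => ((p.1 : (unitDiscMonoid ℂ)ˣ) : unitDiscMonoid ℂ) * (p.2 : unitDiscMonoid ℂ)
           invFun := g
           left_inv := fun _ => split_bijective.1 (hsec _)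
           right_inv := hsec
           continuous_toFun := continuous_splitMap
           continuous_invFun := hg }, fun _ => rfl⟩

/-- **The printed phrase verbatim — "an isomorphism `C^× × C→ ⥲ C` of topological monoids"** (p. 81,
[AbsTopIII] Def. 5.6 (i)) for `(C, C→) = (𝒪^▷_ℂ, (0,1])`: the product map is a bicontinuous isomorphism of
(commutative topological) monoids `(𝒪^▷_ℂ)^× × (0,1] ≃ₜ* 𝒪^▷_ℂ`. [claim: Mochizuki2012, status: disputed] -/
theorem exists_splitContinuousMulEquiv :
    ∃ e : ((unitDiscMonoid ℂ)ˣ × vecC) ≃ₜ* unitDiscMonoid ℂ,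
      ∀ p, e p = ((p.1 : (unitDiscMonoid ℂ)ˣ) : unitDiscMonoid ℂ) * (p.2 : unitDiscMonoid ℂ) := by
  obtain ⟨h, hh⟩ := exists_splitHomeomorph
  refine ⟨{ h with map_mul' := fun p q => ?_ }, hh⟩
  change h (p * q) = h p * h q
  rw [hh, hh, hh, Prod.fst_mul, Prod.snd_mul, Units.val_mul, Submonoid.coe_mul, mul_mul_mul_comm]

end Witness

/-! ### The witness asked for by referee obs M8-O1 / G3-F1 -/

/-- **`(𝒪^▷_ℂ, (0, 1])` satisfies the PRINTED splitting condition of `TM⊢`** (p. 81: "the natural inclusions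
`C^× ↪ C`, `C→ ↪ C` determine an isomorphism `C^× × C→ ⥲ C` of topological monoids"): the product map of
`SplitTopMonoid.ofComplex` is a homeomorphism — PROVED (polar decomposition with continuous inverse
`z ↦ (z/‖z‖, ‖z‖)`). This is the non-vacuity witness promised by the docstring of `SplitTopMonoid.IsTopSplit`.
[claim: Mochizuki2012, status: disputed] -/
theorem SplitTopMonoid.ofComplex_isTopSplit : SplitTopMonoid.ofComplex.IsTopSplit :=
  Witness.exists_splitHomeomorph

/-- Hence the printed hypothesis `IsTopSplit` (to be assumed by statements over "all objects of `TM⊢`",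
e.g. [AbsTopIII] Prop. 5.8 (vi) as used in Ex. 3.4 (ii), (iii)) is satisfiable: such statements are not
vacuous. [claim: Mochizuki2012, status: disputed] -/
theorem SplitTopMonoid.exists_isTopSplit : ∃ M : SplitTopMonoid.{0}, M.IsTopSplit :=
  ⟨SplitTopMonoid.ofComplex, SplitTopMonoid.ofComplex_isTopSplit⟩

end Literature.IUT.HodgeTheaters
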